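import Mathlib.Analysis.Normed.Lp.lpSpace
import Literature.MathematicalPhysics.QuantumFieldTheory.Balaban1983to89.B8SockLettersRD
import Literature.MathematicalPhysics.QuantumFieldTheory.Balaban1983to89.B9SupplySockB9P3ZdLettersOmega
import Literature.MathematicalPhysics.QuantumFieldTheory.Balaban1983to89.B9Eq321LandauProjectionZd

/-!
# `Balaban1983to89.B9Thm31MassiveSiteResolventLinftyZd` — [Balaban1985BackgroundPropagators] Thm 3.1 p. 397 IN ITS NO-AVERAGING CASE («𝔅_k = Λ₀ = T», `Q′ = 1`,
# `Q′*𝔄Q′ = a·η⁻²`), READ ON THE INFINITE LATTICE `T_η ↦ ℤᵈ`: THE MASSIVE SITE RESOLVENT `G′ = (Δ^η_{U₀} + aη⁻²)⁻¹` IS A BOUNDED OPERATOR ON `ℓ^∞(ℤᵈ, 𝔸)` FOR EVERY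
# UNITARY BACKGROUND — Banach's fixed point on `lp (fun _ : Site d => 𝔸) ⊤`; `‖G′w‖ ≤ (η²∕4d)‖w‖`, additivity, `ℂ`-homogeneity, reality, uniqueness (two-sided inverse on
# bounded functions); the SITE twin of dag-n06-b's bond-space `B9SupplySockB9P3ZdUnivWitness` §1

statement-level skeleton of published theorems with citation tags; proofs where landed; nothing here is a claim about the Yang–Mills mass gap

T. Bałaban, *Propagators for lattice gauge theories in a background field*, Commun. Math. Phys. **99** (1985) 389–434 `[Balaban1985BackgroundPropagators]` ("[4]"; journal
page = PDF page + 388): (3.23) p. 394 (`Δ^η_U = D^{η*}_U D^η_U`), (3.24)–(3.25) p. 394 (`G′ = (Δ + Q′*𝔄Q′)⁻¹`), Thm 3.1 p. 397 («|G′(x, y)| ≤ Cη^{2−d}e^{−δη⁻¹|x−y|}» — summed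
over `y` this is an `ℓ^∞ → ℓ^∞` bound `O(η²)`).  T. Bałaban, *Spaces of regular gauge field configurations on a lattice and gauge fixing conditions*, Commun. Math. Phys. **99**
(1985) 75–102 `[Balaban1985RegularSpaces]` ("B8"): (1.1) p. 76 (unitary transporters), p. 77 («we admit the case where some domains Ω_j are equal to T_η»), (1.95)–(1.98)
p. 92, (1.101) p. 93 (the letters `G′`, `R` of the N05 knit's socket `B8SockLettersRD`).

## WHY THIS FILE (cell `pub-ymgap`, HUMAN RULING D-0062; width seat `pub-ymgap-dag-n05-w1` g3, DAG node N05 = [B8]; count-neutral)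

dag-n05-d g13's LOCATED JUNCTION ROAD NOTE (cell bus 2026-08-28 11:04Z): the N05 row's [4]-letters binders live at the (1.3)–(1.5)-admissible members with `Ω₀ = ℤᵈ` (an INFINITE
lattice) while N06's genuine-letter object layer is finite-`Ω₀` linear algebra — «nobody has typed bounded inverses on `ℓ^∞(ℤᵈ, 𝔸)`»; exits = an `ℓ^∞` letter layer or a finite-`Ω₀`
re-pin (planners' word).  dag-n06-b's `B9SupplySockB9P3ZdUnivWitness` §1 built the BOND-space massive inverse `(D*_{U₀}D_{U₀} + a)⁻¹` on `lp ⊤` by Banach's fixed point.  THIS FILE is its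
SITE-space twin — the operator the socket's letter `G′` IS in [4] Thm 3.1's no-averaging case (`𝔅_k = Λ₀ = T`: the empty-tower members `(ℤᵈ, ∅, ∅, …)` of the P₂D index, `Q′ = 1`,
`Q′*𝔄Q′ = a₀η⁻²`): for EVERY unitary `U₀` (no small field) and every `η > 0`, `Δ^η_{U₀} + 8dη⁻²` has a two-sided inverse on bounded site functions, `‖G′w‖ ≤ (η²∕4d)‖w‖`, additive,
`ℂ`-homogeneous, commuting with the adjoint — the first brick of an `ℓ^∞(ℤᵈ, 𝔸)` letter layer, and the HONEST `G′`-clauses (1), (12)–(14) of `SockLettersRD` on bounded inputs at the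
empty-tower sub-class (§3; the degenerate witnesses of `B8SockLettersRDEmptyTowerInhabited` absorb `−Δ` into `𝔄`).

## WHAT IS DECLARED ∕ PROVED (kernel, 0 sorry; definitions WITH BODIES + theorems; no `instance`, no `notation`)

* §1 `SiteSp d 𝔸 := lp (fun _ : Site d => 𝔸) ⊤`; `BddS`; `restrS` (a bounded function AS an element of `ℓ^∞`, `0` if unbounded — declared junk); `LapS η U₀ v := restrS (Δ^η_{U₀} ⇑v)`,
  `‖LapS v‖ ≤ 4dη⁻²‖v‖`, `LapS_add ∕ _sub ∕ _smul`.
* §2 `massS d η := 8dη⁻²`; `PhiS` (Lipschitz `½`); `fpS` = `G′w`; ★ `norm_fpS_le(')` (`‖G′w‖ ≤ (η²∕4d)‖w‖`) · `fpS_add ∕ fpS_smul ∕ fpS_zero` · ★ `fpS_resolvent` (`Δ^η_{U₀}(G′w) +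
  8dη⁻²·G′w = w` POINTWISE) · ★ `restrS_eq_fpS_of_eq` (uniqueness ∕ left inverse) · ★ `fpS_star` (`(G′w)* = G′(w*)`) · `isSelfAdjoint_fpS`.
* §3 ★★ `massive_letter_clauses_on_bounded` — at an EMPTY-TOWER member, `G′ := ext ∘ fpS ∘ restr` satisfies, for BOUNDED inputs: clause (1); clause (12) with the member-free `B_G = 1`
  (`Bd2 f r ⇒ ‖G′f‖ ≤ r ∧ η‖∇_{U₀}G′f‖ ≤ r`); clause (14) reality; and the LEFT inverse.

## HONEST SCOPE

The TRIVIAL MASSIVE REGIME on SITE functions: [4] Thm 3.1 only in its no-averaging case, in `ℓ^∞`-operator-norm form (no kernel decay); the `k ≥ 1` members (`Q′ ≠ 1`: coercivity +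
decay) untouched; the all-functions clause (1) of `SockLettersRD` for UNBOUNDED sources is not claimed here.  Count-neutral; N05 ∕ N06 NOT discharged; no count claim; `T_η ↦ ℤᵈ`; one
finite `𝕋⁴` programme at fixed `ε`, Bałaban as printed — the Yang–Mills mass gap (Clay) is NOT proved by any of this; R4 closes the conditional finite-`𝕋⁴` rung `BalabanLadder.UV` only;
nothing continuum ∕ ℝ⁴ ∕ OS.  Unit `pub-ymgap-dag-n05-w1` (g3), 2026-08-28.

[cite: Balaban1985BackgroundPropagators, (3.23)–(3.25) p.394, Thm 3.1 p.397; Balaban1985RegularSpaces, (1.1) p.76, p.77, (1.95)–(1.98) p.92, (1.101) p.93]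
-/

noncomputable section

open NormedSpace

namespace Literature.MathematicalPhysics.QuantumFieldTheory.Balaban1983to89.B9Thm31MassiveSiteResolventLinftyZd

open B7Prop1Explicit (e U1)
open B7Prop2Explicit (unitaryUnits unitaryUnits_le_U1)
open B8Ineq132 (covDerivFwd)
open B8Eq138LandauZd (covLap covLap_zero)
open B8Prop5ContractionKLevel (Bd2)
open B8LambdaSpaceKLevel (wt)
open B9SupplySockB9P3ZdLettersOmega (norm_covDerivFwd_le norm_covLap_le covLap_add)
open B8Prop5JoinSectE (covLap_smul)
open B9Eq321LandauProjectionZd (star_covLap)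

-- `Site` alone could resolve to the torus sites of `Setup.lean`; re-export the `ℤ^d` sites of `B7Prop1Explicit`.
export B7Prop1Explicit (Site)

variable {d : ℕ} {𝔸 : Type*} [CStarAlgebra 𝔸]

/-! ## §1 `ℓ^∞(ℤᵈ, 𝔸)` of site functions, the embedding of bounded functions, the covariant Laplacian on it -/

section Space

variable (d 𝔸) in
/-- **`ℓ^∞` of the sites of `ℤᵈ`** with values in `𝔸` — the Banach space carrying `G′` at `Ω₀ = T_η` read as `ℤᵈ`. [cite: Balaban1985BackgroundPropagators, (3.24) p.394; Balaban1985RegularSpaces, p.77] -/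
abbrev SiteSp : Type _ := lp (fun _ : Site d => 𝔸) ⊤

/-- A uniformly bounded site function. [cite: Balaban1985RegularSpaces, (1.98) p.92 (the weighted sup norms at truncation 0)] -/
def BddS (f : Site d → 𝔸) : Prop := ∃ C : ℝ, ∀ x : Site d, ‖f x‖ ≤ C

/-- A bounded site function is an element of `ℓ^∞`. [cite: Balaban1985BackgroundPropagators, (3.24) p.394] -/
theorem memℓp_of_bddS {f : Site d → 𝔸} (h : BddS f) : Memℓp (fun x : Site d => f x) ⊤ := by
  obtain ⟨C, hC⟩ := h
  exact memℓp_infty ⟨C, by rintro _ ⟨x, rfl⟩; exact hC x⟩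

open Classical in
/-- **`restr`**: a site function AS an element of `ℓ^∞` (`0` if unbounded — declared junk, never read). [cite: Balaban1985BackgroundPropagators, (3.24) p.394] -/
def restrS (f : Site d → 𝔸) : SiteSp d 𝔸 :=
  if h : BddS f then ⟨fun x => f x, memℓp_of_bddS h⟩ else 0

/-- `restr f = f` pointwise for a bounded function. [cite: Balaban1985BackgroundPropagators, (3.24) p.394] -/
theorem restrS_apply {f : Site d → 𝔸} (h : BddS f) (x : Site d) : restrS f x = f x := by
  rw [restrS, dif_pos h]

/-- `restr f = 0` for an unbounded function (junk). [cite: Balaban1985RegularSpaces, p.92 (bookkeeping)] -/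
theorem restrS_of_not {f : Site d → 𝔸} (h : ¬ BddS f) : restrS f = 0 := by
  rw [restrS, dif_neg h]

/-- `‖restr f‖ ≤ C` from a pointwise bound `‖f‖ ≤ C`, `C ≥ 0`. [cite: Balaban1985BackgroundPropagators, (3.24) p.394] -/
theorem norm_restrS_le {f : Site d → 𝔸} {C : ℝ} (hC : 0 ≤ C) (h : ∀ x : Site d, ‖f x‖ ≤ C) : ‖restrS f‖ ≤ C := by
  have hb : BddS f := ⟨C, h⟩
  exact lp.norm_le_of_forall_le hC fun x => by rw [restrS_apply hb]; exact h x

/-- Sums of bounded functions are bounded. [cite: Balaban1985BackgroundPropagators, (3.24) p.394 (bookkeeping: the ℓ^∞ carrier is a subspace)] -/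
theorem BddS.add {f g : Site d → 𝔸} (h₁ : BddS f) (h₂ : BddS g) : BddS (f + g) := by
  obtain ⟨C₁, hC₁⟩ := h₁
  obtain ⟨C₂, hC₂⟩ := h₂
  exact ⟨C₁ + C₂, fun x => (norm_add_le _ _).trans (add_le_add (hC₁ x) (hC₂ x))⟩

/-- Scalar multiples of bounded functions are bounded. [cite: Balaban1985BackgroundPropagators, (3.24) p.394 (bookkeeping)] -/
theorem BddS.smul {f : Site d → 𝔸} (c : ℂ) (h : BddS f) : BddS (c • f) := by
  obtain ⟨C, hC⟩ := h
  exact ⟨‖c‖ * C, fun x => by rw [Pi.smul_apply, norm_smul]; exact mul_le_mul_of_nonneg_left (hC x) (norm_nonneg _)⟩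

/-- Pointwise adjoints of bounded functions are bounded. [cite: Balaban1985BackgroundPropagators, (3.21) p.394 (bookkeeping: the adjoint on the carrier)] -/
theorem BddS.star {f : Site d → 𝔸} (h : BddS f) : BddS (fun x => star (f x)) := by
  obtain ⟨C, hC⟩ := h
  exact ⟨C, fun x => by rw [norm_star]; exact hC x⟩

/-- `restr` is additive on bounded functions. [cite: Balaban1985BackgroundPropagators, (3.24) p.394 (bookkeeping)] -/
theorem restrS_add {f g : Site d → 𝔸} (h₁ : BddS f) (h₂ : BddS g) : restrS (f + g) = restrS f + restrS g := by
  ext x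
  simp only [lp.coeFn_add, Pi.add_apply, restrS_apply (h₁.add h₂), restrS_apply h₁, restrS_apply h₂]

/-- `restr` is `ℂ`-homogeneous on bounded functions. [cite: Balaban1985BackgroundPropagators, (3.24) p.394 (bookkeeping)] -/
theorem restrS_smul (c : ℂ) {f : Site d → 𝔸} (h : BddS f) : restrS (c • f) = c • restrS f := by
  ext x
  simp only [lp.coeFn_smul, Pi.smul_apply, restrS_apply (h.smul c), restrS_apply h]

/-- An element of `ℓ^∞`, read as a site function, is bounded by its norm. [cite: Balaban1985BackgroundPropagators, (3.24) p.394] -/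
theorem norm_coe_le (v : SiteSp d 𝔸) (x : Site d) : ‖v x‖ ≤ ‖v‖ :=
  lp.norm_apply_le_norm ENNReal.top_ne_zero v x

/-- An element of `ℓ^∞` is a bounded function. [cite: Balaban1985BackgroundPropagators, (3.24) p.394 (bookkeeping)] -/
theorem bddS_coe (v : SiteSp d 𝔸) : BddS (⇑v : Site d → 𝔸) := ⟨‖v‖, norm_coe_le v⟩

/-- `restr ⇑v = v`. [cite: Balaban1985BackgroundPropagators, (3.24) p.394 (bookkeeping)] -/
theorem restrS_coe (v : SiteSp d 𝔸) : restrS (⇑v : Site d → 𝔸) = v := by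
  ext x; rw [restrS_apply (bddS_coe v)]

/-- **`Δ^η_{U₀}` on `ℓ^∞`**: `LapS v := restr (Δ^η_{U₀} ⇑v)` ((3.23); an element of `ℓ^∞` junk-free for unitary `U₀`, `LapS_apply`). [cite: Balaban1985BackgroundPropagators, (3.23) p.394] -/
def LapS (η : ℝ) (U₀ : Site d → Fin d → 𝔸ˣ) (v : SiteSp d 𝔸) : SiteSp d 𝔸 :=
  restrS fun x => covLap η U₀ (⇑v) x

variable [Nontrivial 𝔸]

/-- `‖(Δ^η_{U₀} ⇑v)(x)‖ ≤ 4dη⁻²‖v‖` for unitary `U₀` (`norm_covLap_le`). [cite: Balaban1985BackgroundPropagators, (3.23) p.394; Balaban1985RegularSpaces, (1.1) p.76] -/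
theorem norm_covLap_coe_le {η : ℝ} (hη : 0 < η) {U₀ : Site d → Fin d → 𝔸ˣ} (hU₀ : ∀ x κ, U₀ x κ ∈ unitaryUnits 𝔸) (v : SiteSp d 𝔸) (x : Site d) :
    ‖covLap η U₀ (⇑v) x‖ ≤ 4 * d * η⁻¹ * η⁻¹ * ‖v‖ := by
  have hU1 : ∀ y κ, U₀ y κ ∈ U1 𝔸 := fun y κ => unitaryUnits_le_U1 (hU₀ y κ)
  calc ‖covLap η U₀ (⇑v) x‖ ≤ 4 * d * (η⁻¹ * (η⁻¹ * ‖v‖)) := norm_covLap_le hη hU1 (norm_coe_le v) x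
    _ = 4 * d * η⁻¹ * η⁻¹ * ‖v‖ := by ring

/-- `Δ^η_{U₀} ⇑v` is bounded for unitary `U₀`. [cite: Balaban1985BackgroundPropagators, (3.23) p.394] -/
theorem bddS_covLap_coe {η : ℝ} (hη : 0 < η) {U₀ : Site d → Fin d → 𝔸ˣ} (hU₀ : ∀ x κ, U₀ x κ ∈ unitaryUnits 𝔸) (v : SiteSp d 𝔸) :
    BddS fun x => covLap η U₀ (⇑v) x :=
  ⟨_, fun x => norm_covLap_coe_le hη hU₀ v x⟩

/-- `(LapS v)(x) = (Δ^η_{U₀} ⇑v)(x)` for unitary `U₀`. [cite: Balaban1985BackgroundPropagators, (3.23) p.394] -/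
theorem LapS_apply {η : ℝ} (hη : 0 < η) {U₀ : Site d → Fin d → 𝔸ˣ} (hU₀ : ∀ x κ, U₀ x κ ∈ unitaryUnits 𝔸) (v : SiteSp d 𝔸) (x : Site d) :
    LapS η U₀ v x = covLap η U₀ (⇑v) x := by
  rw [LapS, restrS_apply (bddS_covLap_coe hη hU₀ v)]

/-- **`‖Δ^η_{U₀}v‖_∞ ≤ 4dη⁻²‖v‖_∞` uniformly in the unitary background.** [cite: Balaban1985BackgroundPropagators, (3.23) p.394; Balaban1985RegularSpaces, (1.1) p.76] -/
theorem norm_LapS_le {η : ℝ} (hη : 0 < η) {U₀ : Site d → Fin d → 𝔸ˣ} (hU₀ : ∀ x κ, U₀ x κ ∈ unitaryUnits 𝔸) (v : SiteSp d 𝔸) :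
    ‖LapS η U₀ v‖ ≤ 4 * d * η⁻¹ * η⁻¹ * ‖v‖ :=
  norm_restrS_le (by positivity) fun x => norm_covLap_coe_le hη hU₀ v x

/-- `LapS` is additive. [cite: Balaban1985BackgroundPropagators, (3.23) p.394 (linearity)] -/
theorem LapS_add {η : ℝ} (hη : 0 < η) {U₀ : Site d → Fin d → 𝔸ˣ} (hU₀ : ∀ x κ, U₀ x κ ∈ unitaryUnits 𝔸) (v w : SiteSp d 𝔸) :
    LapS η U₀ (v + w) = LapS η U₀ v + LapS η U₀ w := by
  ext x
  simp only [lp.coeFn_add, Pi.add_apply, LapS_apply hη hU₀]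
  exact covLap_add η U₀ (⇑v) (⇑w) x

/-- `LapS` is `ℂ`-homogeneous. [cite: Balaban1985BackgroundPropagators, (3.23) p.394 (linearity)] -/
theorem LapS_smul {η : ℝ} (hη : 0 < η) {U₀ : Site d → Fin d → 𝔸ˣ} (hU₀ : ∀ x κ, U₀ x κ ∈ unitaryUnits 𝔸) (c : ℂ) (v : SiteSp d 𝔸) :
    LapS η U₀ (c • v) = c • LapS η U₀ v := by
  ext x
  simp only [lp.coeFn_smul, Pi.smul_apply, LapS_apply hη hU₀]
  exact covLap_smul η U₀ c (⇑v) x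

/-- `LapS` is subtractive. [cite: Balaban1985BackgroundPropagators, (3.23) p.394 (linearity)] -/
theorem LapS_sub {η : ℝ} (hη : 0 < η) {U₀ : Site d → Fin d → 𝔸ˣ} (hU₀ : ∀ x κ, U₀ x κ ∈ unitaryUnits 𝔸) (v w : SiteSp d 𝔸) :
    LapS η U₀ (v - w) = LapS η U₀ v - LapS η U₀ w := by
  rw [sub_eq_add_neg, LapS_add hη hU₀, ← neg_one_smul ℂ w, LapS_smul hη hU₀, neg_one_smul, ← sub_eq_add_neg]

end Space

/-! ## §2 The massive resolvent `G′ = (Δ^η_{U₀} + 8dη⁻²)⁻¹` on `ℓ^∞` by Banach's fixed point -/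

section Resolvent

variable [Nontrivial 𝔸]

variable (d) in
/-- The mass `a·η⁻²` with `a = 8d` (twice the `ℓ^∞` bound of `Δ^η_{U₀}`, so the fixed-point map is a `½`-contraction). [cite: Balaban1985BackgroundPropagators, (3.24)–(3.25) p.394 («𝔄» positive)] -/
def massS (η : ℝ) : ℝ := 8 * d * η⁻¹ * η⁻¹

/-- The contraction `Φ_w(v) = (8dη⁻²)⁻¹(w − Δ^η_{U₀}v)` whose fixed point solves `(Δ^η_{U₀} + 8dη⁻²)v = w`. [cite: Balaban1985BackgroundPropagators, (3.25) p.394] -/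
def PhiS (η : ℝ) (U₀ : Site d → Fin d → 𝔸ˣ) (w v : SiteSp d 𝔸) : SiteSp d 𝔸 :=
  (massS d η)⁻¹ • (w - LapS η U₀ v)

/-- `Φ_w` is a `½`-contraction for every unitary `U₀` and every `w` (`d ≥ 1`, `η > 0`). [cite: Balaban1985BackgroundPropagators, (3.25) p.394] -/
theorem phiS_contracting (hd : 1 ≤ d) {η : ℝ} (hη : 0 < η) {U₀ : Site d → Fin d → 𝔸ˣ} (hU₀ : ∀ x κ, U₀ x κ ∈ unitaryUnits 𝔸)
    (w : SiteSp d 𝔸) : ContractingWith (1 / 2) (PhiS η U₀ w) := by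
  have hdpos : (0 : ℝ) < d := by exact_mod_cast hd
  have ha : 0 < massS d η := by unfold massS; positivity
  have hhalf : ((1 / 2 : NNReal) : ℝ) = 1 / 2 := by norm_num
  refine ⟨by norm_num, LipschitzWith.of_dist_le_mul fun v v' => ?_⟩
  rw [dist_eq_norm, dist_eq_norm, PhiS, PhiS, ← smul_sub, sub_sub_sub_cancel_left, norm_smul,
    Real.norm_of_nonneg (inv_nonneg.mpr ha.le), ← LapS_sub hη hU₀, norm_sub_rev v v', hhalf]
  calc (massS d η)⁻¹ * ‖LapS η U₀ (v' - v)‖ ≤ (massS d η)⁻¹ * (4 * d * η⁻¹ * η⁻¹ * ‖v' - v‖) :=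
        mul_le_mul_of_nonneg_left (norm_LapS_le hη hU₀ (v' - v)) (inv_nonneg.mpr ha.le)
    _ = 1 / 2 * ‖v' - v‖ := by unfold massS; field_simp; ring

/-- **`G′w`**: the fixed point of `Φ_w`, the unique `v ∈ ℓ^∞` with `(Δ^η_{U₀} + 8dη⁻²)v = w` (Banach's theorem on `ℓ^∞(ℤᵈ, 𝔸)`).
[cite: Balaban1985BackgroundPropagators, (3.25) p.394, Thm 3.1 p.397] -/
def fpS (hd : 1 ≤ d) {η : ℝ} (hη : 0 < η) {U₀ : Site d → Fin d → 𝔸ˣ} (hU₀ : ∀ x κ, U₀ x κ ∈ unitaryUnits 𝔸) (w : SiteSp d 𝔸) : SiteSp d 𝔸 :=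
  ContractingWith.fixedPoint (PhiS η U₀ w) (phiS_contracting hd hη hU₀ w)

/-- The fixed-point equation. [cite: Balaban1985BackgroundPropagators, (3.25) p.394] -/
theorem fpS_eq (hd : 1 ≤ d) {η : ℝ} (hη : 0 < η) {U₀ : Site d → Fin d → 𝔸ˣ} (hU₀ : ∀ x κ, U₀ x κ ∈ unitaryUnits 𝔸) (w : SiteSp d 𝔸) :
    PhiS η U₀ w (fpS hd hη hU₀ w) = fpS hd hη hU₀ w :=
  (phiS_contracting hd hη hU₀ w).fixedPoint_isFixedPt

/-- Uniqueness of the fixed point. [cite: Balaban1985BackgroundPropagators, (3.25) p.394] -/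
theorem fpS_unique (hd : 1 ≤ d) {η : ℝ} (hη : 0 < η) {U₀ : Site d → Fin d → 𝔸ˣ} (hU₀ : ∀ x κ, U₀ x κ ∈ unitaryUnits 𝔸) (w : SiteSp d 𝔸)
    {v : SiteSp d 𝔸} (hv : PhiS η U₀ w v = v) : v = fpS hd hη hU₀ w :=
  (phiS_contracting hd hη hU₀ w).fixedPoint_unique hv

/-- ★ **`‖G′w‖_∞ ≤ 2(8dη⁻²)⁻¹‖w‖_∞ = (η²∕4d)‖w‖_∞`** — [4] Thm 3.1's bound in `ℓ^∞`-operator form, for EVERY unitary background.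
[cite: Balaban1985BackgroundPropagators, Thm 3.1 p.397, (3.25) p.394] -/
theorem norm_fpS_le (hd : 1 ≤ d) {η : ℝ} (hη : 0 < η) {U₀ : Site d → Fin d → 𝔸ˣ} (hU₀ : ∀ x κ, U₀ x κ ∈ unitaryUnits 𝔸) (w : SiteSp d 𝔸) :
    ‖fpS hd hη hU₀ w‖ ≤ 2 * (massS d η)⁻¹ * ‖w‖ := by
  have hdpos : (0 : ℝ) < d := by exact_mod_cast hd
  have ha : 0 < massS d η := by unfold massS; positivity
  set v := fpS hd hη hU₀ w with hv
  have h1 : v = (massS d η)⁻¹ • (w - LapS η U₀ v) := (fpS_eq hd hη hU₀ w).symm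
  have hK : ‖LapS η U₀ v‖ ≤ (massS d η) / 2 * ‖v‖ := by
    calc ‖LapS η U₀ v‖ ≤ 4 * d * η⁻¹ * η⁻¹ * ‖v‖ := norm_LapS_le hη hU₀ v
      _ = (massS d η) / 2 * ‖v‖ := by unfold massS; ring
  have h2 : ‖v‖ ≤ (massS d η)⁻¹ * (‖w‖ + (massS d η) / 2 * ‖v‖) := by
    calc ‖v‖ = ‖(massS d η)⁻¹ • (w - LapS η U₀ v)‖ := by rw [← h1]
      _ = (massS d η)⁻¹ * ‖w - LapS η U₀ v‖ := by rw [norm_smul, Real.norm_of_nonneg (inv_nonneg.mpr ha.le)]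
      _ ≤ (massS d η)⁻¹ * (‖w‖ + ‖LapS η U₀ v‖) := mul_le_mul_of_nonneg_left (norm_sub_le _ _) (inv_nonneg.mpr ha.le)
      _ ≤ (massS d η)⁻¹ * (‖w‖ + (massS d η) / 2 * ‖v‖) := by gcongr
  have h3 : (massS d η)⁻¹ * ((massS d η) / 2 * ‖v‖) = ‖v‖ / 2 := by field_simp
  rw [mul_add, h3] at h2
  linarith

/-- `‖G′w‖_∞ ≤ (η²∕4d)‖w‖_∞`, the same bound with the mass spelled out. [cite: Balaban1985BackgroundPropagators, Thm 3.1 p.397] -/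
theorem norm_fpS_le' (hd : 1 ≤ d) {η : ℝ} (hη : 0 < η) {U₀ : Site d → Fin d → 𝔸ˣ} (hU₀ : ∀ x κ, U₀ x κ ∈ unitaryUnits 𝔸) (w : SiteSp d 𝔸) :
    ‖fpS hd hη hU₀ w‖ ≤ η ^ 2 / (4 * d) * ‖w‖ := by
  have hdpos : (0 : ℝ) < d := by exact_mod_cast hd
  have h := norm_fpS_le hd hη hU₀ w
  have he : 2 * (massS d η)⁻¹ = η ^ 2 / (4 * d) := by
    unfold massS; field_simp; ring
  rwa [he] at h

/-- `G′` is ADDITIVE: uniqueness + additivity of `Δ^η_{U₀}`. [cite: Balaban1985BackgroundPropagators, (3.25) p.394] -/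
theorem fpS_add (hd : 1 ≤ d) {η : ℝ} (hη : 0 < η) {U₀ : Site d → Fin d → 𝔸ˣ} (hU₀ : ∀ x κ, U₀ x κ ∈ unitaryUnits 𝔸) (w₁ w₂ : SiteSp d 𝔸) :
    fpS hd hη hU₀ (w₁ + w₂) = fpS hd hη hU₀ w₁ + fpS hd hη hU₀ w₂ := by
  symm
  refine fpS_unique hd hη hU₀ (w₁ + w₂) ?_
  have h₁ := fpS_eq hd hη hU₀ w₁
  have h₂ := fpS_eq hd hη hU₀ w₂
  simp only [PhiS] at h₁ h₂ ⊢
  rw [LapS_add hη hU₀, ← h₁, ← h₂, ← smul_add]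
  congr 1
  rw [h₁, h₂]
  abel

/-- `G′` is `ℂ`-HOMOGENEOUS: uniqueness + homogeneity of `Δ^η_{U₀}`. [cite: Balaban1985BackgroundPropagators, (3.25) p.394] -/
theorem fpS_smul (hd : 1 ≤ d) {η : ℝ} (hη : 0 < η) {U₀ : Site d → Fin d → 𝔸ˣ} (hU₀ : ∀ x κ, U₀ x κ ∈ unitaryUnits 𝔸) (c : ℂ) (w : SiteSp d 𝔸) :
    fpS hd hη hU₀ (c • w) = c • fpS hd hη hU₀ w := by
  symm
  refine fpS_unique hd hη hU₀ (c • w) ?_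
  have h := fpS_eq hd hη hU₀ w
  simp only [PhiS] at h ⊢
  rw [LapS_smul hη hU₀, ← smul_sub, smul_comm, h]

/-- `G′0 = 0`. [cite: Balaban1985BackgroundPropagators, (3.25) p.394] -/
theorem fpS_zero (hd : 1 ≤ d) {η : ℝ} (hη : 0 < η) {U₀ : Site d → Fin d → 𝔸ˣ} (hU₀ : ∀ x κ, U₀ x κ ∈ unitaryUnits 𝔸) :
    fpS hd hη hU₀ (0 : SiteSp d 𝔸) = 0 := by
  have h := fpS_smul hd hη hU₀ 0 (0 : SiteSp d 𝔸)
  rwa [zero_smul, zero_smul] at h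

/-- ★ **THE RESOLVENT EQUATION, POINTWISE**: `(Δ^η_{U₀}G′w)(x) + 8dη⁻²·(G′w)(x) = w(x)` at every site — [4] (3.25) with `Q′ = 1`, `𝔄 = 8dη⁻²`.
[cite: Balaban1985BackgroundPropagators, (3.25) p.394, Thm 3.1 p.397] -/
theorem fpS_resolvent (hd : 1 ≤ d) {η : ℝ} (hη : 0 < η) {U₀ : Site d → Fin d → 𝔸ˣ} (hU₀ : ∀ x κ, U₀ x κ ∈ unitaryUnits 𝔸) (w : SiteSp d 𝔸) (x : Site d) :
    covLap η U₀ (⇑(fpS hd hη hU₀ w)) x + (massS d η : ℂ) • fpS hd hη hU₀ w x = w x := by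
  have hdpos : (0 : ℝ) < d := by exact_mod_cast hd
  have ha : 0 < massS d η := by unfold massS; positivity
  set v := fpS hd hη hU₀ w with hv
  have h1 : (massS d η)⁻¹ • (w - LapS η U₀ v) = v := fpS_eq hd hη hU₀ w
  have h2 : (massS d η : ℝ) • v = w - LapS η U₀ v := by
    conv_lhs => rw [← h1]
    rw [smul_smul, mul_inv_cancel₀ ha.ne', one_smul]
  have h3 := congrArg (fun u : SiteSp d 𝔸 => u x) h2
  simp only [lp.coeFn_smul, lp.coeFn_sub, Pi.smul_apply, Pi.sub_apply, LapS_apply hη hU₀] at h3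
  rw [Complex.coe_smul, h3]
  abel

/-- ★ **UNIQUENESS ∕ LEFT INVERSE**: a BOUNDED `A` with `Δ^η_{U₀}A + 8dη⁻²A = J` everywhere IS `G′J` (`restr A = G′(restr J)`).
[cite: Balaban1985BackgroundPropagators, Thm 3.1 p.397 (G′ is THE inverse), (3.25) p.394] -/
theorem restrS_eq_fpS_of_eq (hd : 1 ≤ d) {η : ℝ} (hη : 0 < η) {U₀ : Site d → Fin d → 𝔸ˣ} (hU₀ : ∀ x κ, U₀ x κ ∈ unitaryUnits 𝔸)
    {A J : Site d → 𝔸} (hA : BddS A) (hJ : ∀ y : Site d, J y = covLap η U₀ A y + (massS d η : ℂ) • A y) :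
    restrS A = fpS hd hη hU₀ (restrS J) := by
  have hdpos : (0 : ℝ) < d := by exact_mod_cast hd
  have ha : 0 < massS d η := by unfold massS; positivity
  have hU1 : ∀ y κ, U₀ y κ ∈ U1 𝔸 := fun y κ => unitaryUnits_le_U1 (hU₀ y κ)
  have hJb : BddS J := by
    obtain ⟨C, hC⟩ := hA
    refine ⟨4 * d * (η⁻¹ * (η⁻¹ * C)) + ‖(massS d η : ℂ)‖ * C, fun y => ?_⟩
    rw [hJ y]
    refine (norm_add_le _ _).trans (add_le_add (norm_covLap_le hη hU1 hC y) ?_)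
    rw [norm_smul]
    exact mul_le_mul_of_nonneg_left (hC y) (norm_nonneg _)
  refine fpS_unique hd hη hU₀ (restrS J) ?_
  ext x
  have hK : LapS η U₀ (restrS A) x = covLap η U₀ A x := by
    rw [LapS_apply hη hU₀]
    have hAe : (⇑(restrS A) : Site d → 𝔸) = A := funext fun z => restrS_apply hA z
    rw [hAe]
  simp only [PhiS, lp.coeFn_smul, lp.coeFn_sub, Pi.smul_apply, Pi.sub_apply, hK, restrS_apply hJb, restrS_apply hA, hJ x,
    add_sub_cancel_left, Complex.coe_smul, smul_smul, inv_mul_cancel₀ ha.ne', one_smul]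

/-- ★ **`G′` COMMUTES WITH THE POINTWISE ADJOINT** for a unitary background: `(G′w)* = G′(w*)` — the adjoint of the fixed point of `Φ_w` is the fixed point of `Φ_{w*}`
(`star_covLap`; uniqueness). [cite: Balaban1985BackgroundPropagators, (3.21)–(3.23) p.394; Balaban1985RegularSpaces, (1.101) p.93 (reality of G′)] -/
theorem fpS_star (hd : 1 ≤ d) {η : ℝ} (hη : 0 < η) {U₀ : Site d → Fin d → 𝔸ˣ} (hU₀ : ∀ x κ, U₀ x κ ∈ unitaryUnits 𝔸) (w : SiteSp d 𝔸) :
    restrS (fun y => star (fpS hd hη hU₀ w y)) = fpS hd hη hU₀ (restrS fun y => star (w y)) := by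
  have hdpos : (0 : ℝ) < d := by exact_mod_cast hd
  have ha : 0 < massS d η := by unfold massS; positivity
  set v := fpS hd hη hU₀ w with hv
  set u : SiteSp d 𝔸 := restrS fun y => star (v y) with huDef
  set ws : SiteSp d 𝔸 := restrS fun y => star (w y) with hwsDef
  have hub : BddS (fun y => star (v y)) := (bddS_coe v).star
  have hwb : BddS (fun y => star (w y)) := (bddS_coe w).star
  have hu : ∀ y, u y = star (v y) := fun y => restrS_apply hub y
  have hws : ∀ y, ws y = star (w y) := fun y => restrS_apply hwb y
  have hue : (⇑u : Site d → 𝔸) = fun y => star (v y) := funext hu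
  have h1 : PhiS η U₀ w v = v := fpS_eq hd hη hU₀ w
  have hstar : ∀ z : 𝔸, star ((massS d η)⁻¹ • z) = (massS d η)⁻¹ • star z := fun z => by
    rw [← Complex.coe_smul, star_smul, ← Complex.coe_smul]
    simp
  refine fpS_unique hd hη hU₀ ws ?_
  ext y
  have h1y : (massS d η)⁻¹ • (w y - covLap η U₀ (⇑v) y) = v y := by
    have h := congrArg (fun z : SiteSp d 𝔸 => z y) h1
    simpa only [PhiS, lp.coeFn_smul, lp.coeFn_sub, Pi.smul_apply, Pi.sub_apply, LapS_apply hη hU₀] using h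
  have hL : covLap η U₀ (⇑u) y = star (covLap η U₀ (⇑v) y) := by rw [hue, star_covLap η hU₀ (⇑v) y]
  simp only [PhiS, lp.coeFn_smul, lp.coeFn_sub, Pi.smul_apply, Pi.sub_apply, LapS_apply hη hU₀]
  rw [hL, hws y, hu y, ← h1y, hstar, star_sub]

/-- ★ **REALITY**: if `w` is Hermitian-valued so is `G′w` (unitary background). [cite: Balaban1985BackgroundPropagators, (3.21)–(3.23) p.394; Balaban1985RegularSpaces, (1.101) p.93] -/
theorem isSelfAdjoint_fpS (hd : 1 ≤ d) {η : ℝ} (hη : 0 < η) {U₀ : Site d → Fin d → 𝔸ˣ} (hU₀ : ∀ x κ, U₀ x κ ∈ unitaryUnits 𝔸) (w : SiteSp d 𝔸)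
    (hw : ∀ x : Site d, IsSelfAdjoint (w x)) (x : Site d) : IsSelfAdjoint (fpS hd hη hU₀ w x) := by
  have hws : (restrS fun y => star (w y)) = w := by
    have : (fun y => star (w y)) = (⇑w : Site d → 𝔸) := funext fun y => (hw y).star_eq
    rw [this, restrS_coe]
  have h := fpS_star hd hη hU₀ w
  rw [hws] at h
  have hy := congrArg (fun z : SiteSp d 𝔸 => z x) h
  simp only at hy
  rw [restrS_apply ((bddS_coe _).star)] at hy
  exact hy

end Resolvent

/-! ## §3 The `G′`-clauses of the N05 socket at an empty-tower member, HONEST on bounded inputs -/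

section Clauses

variable [Nontrivial 𝔸]

/-- ★★ **THE `G′`-LETTER CLAUSES OF `B8SockLettersRD.SockLettersRD` AT AN EMPTY-TOWER MEMBER, HONESTLY**: at a member with `Ω 0 = ℤᵈ` and `Ω j = ∅` for `j ≥ 1` (so `Q′ = 1` on
`Λ₀ = ℤᵈ` and print's `Q′*𝔄Q′ = a₀η⁻²`, here `a₀ = 8d`), for every unitary `U₀`, every `η > 0` and every truncation `n`, the operator `G′ := ext ∘ (Δ^η_{U₀} + 8dη⁻²)⁻¹ ∘ restr`
satisfies, for every BOUNDED input: clause (1) `Δ^η_{U₀}(G′x) + 8dη⁻²·G′x = x` at every site; clause (12) with the member-free constant `B_G = 1` — `Bd2 f r` (i.e. `η²‖f‖ ≤ r` at this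
member) gives `‖G′f y‖ ≤ r` and `wt·‖∇_{U₀}G′f‖ ≤ r` at level `0`, the only level with bonds; clause (14) reality; and `G′` is the LEFT inverse too.  (The degenerate all-functions
witnesses of `B8SockLettersRDEmptyTowerInhabited` ∕ `…ClassUniform` absorb `−Δ` into `𝔄`; here `𝔄 = 8dη⁻²` is print's positive multiple of the identity.)
[cite: Balaban1985BackgroundPropagators, (3.23)–(3.25) p.394, Thm 3.1 p.397; Balaban1985RegularSpaces, (1.95)–(1.98) p.92, (1.101) p.93] -/
theorem massive_letter_clauses_on_bounded (hd : 1 ≤ d) {η : ℝ} (hη : 0 < η) {U₀ : Site d → Fin d → 𝔸ˣ} (hU₀ : ∀ x κ, U₀ x κ ∈ unitaryUnits 𝔸)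
    {L k n : ℕ} {Ω : ℕ → Set (Site d)} (hΩ0 : Ω 0 = Set.univ) (_hΩ : ∀ j, 1 ≤ j → Ω j = ∅) (_hn : n ≤ k) :
    let G : (Site d → 𝔸) → Site d → 𝔸 := fun f => ⇑(fpS hd hη hU₀ (restrS f))
    (∀ x : Site d → 𝔸, BddS x → ∀ y : Site d, covLap η U₀ (G x) y + (massS d η : ℂ) • G x y = x y) ∧
    (∀ (f : Site d → 𝔸) (r : ℝ), 0 ≤ r → Bd2 (𝔸 := 𝔸) L η n Ω f r →
      (∀ y, ‖G f y‖ ≤ 1 * r) ∧ ∀ (y : Site d) (κ : Fin d), wt L η 0 * ‖covDerivFwd η U₀ κ (G f) y‖ ≤ 1 * r) ∧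
    (∀ f : Site d → 𝔸, BddS f → (∀ y, IsSelfAdjoint (f y)) → ∀ y, IsSelfAdjoint (G f y)) ∧
    (∀ u : Site d → 𝔸, BddS u → G (fun y => covLap η U₀ u y + (massS d η : ℂ) • u y) = u) := by
  intro G
  have hdpos : (0 : ℝ) < d := by exact_mod_cast hd
  have hd1 : (1 : ℝ) ≤ d := by exact_mod_cast hd
  have hη2 : 0 < η ^ 2 := by positivity
  have hU1 : ∀ y κ, U₀ y κ ∈ U1 𝔸 := fun y κ => unitaryUnits_le_U1 (hU₀ y κ)
  refine ⟨fun x hx y => ?_, fun f r hr hf => ?_, fun f hf hsa y => ?_, fun u hu => ?_⟩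
  · -- (1): the resolvent equation for the bounded source `x`
    have h := fpS_resolvent hd hη hU₀ (restrS x) y
    rwa [restrS_apply hx] at h
  · -- (12): `Bd2 f r` at this member is `η²‖f‖ ≤ r` everywhere, so `‖restr f‖ ≤ r∕η²` and `‖G′f‖ ≤ (η²∕4d)(r∕η²) ≤ r`
    have hfb : ∀ y, ‖f y‖ ≤ (η ^ 2)⁻¹ * r := fun y => by
      have h := hf 0 (Nat.zero_le n) y (by rw [hΩ0]; exact Set.mem_univ y)
      simp only [wt, pow_zero, one_mul] at h
      rw [inv_mul_eq_div, le_div_iff₀ hη2]; linarith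
    have hrη : 0 ≤ (η ^ 2)⁻¹ * r := by positivity
    have hG : ∀ y, ‖G f y‖ ≤ r / (4 * d) := fun y => by
      calc ‖G f y‖ ≤ ‖fpS hd hη hU₀ (restrS f)‖ := norm_coe_le _ y
        _ ≤ η ^ 2 / (4 * d) * ‖restrS f‖ := norm_fpS_le' hd hη hU₀ _
        _ ≤ η ^ 2 / (4 * d) * ((η ^ 2)⁻¹ * r) := mul_le_mul_of_nonneg_left (norm_restrS_le hrη hfb) (by positivity)
        _ = r / (4 * d) := by field_simp
    have hG' : ∀ y, ‖G f y‖ ≤ r / 2 := fun y =>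
      (hG y).trans (div_le_div_of_nonneg_left hr (by norm_num) (by linarith))
    refine ⟨fun y => (hG' y).trans (by linarith), fun y κ => ?_⟩
    have h1 : ‖covDerivFwd η U₀ κ (G f) y‖ ≤ η⁻¹ * (r / 2 + r / 2) :=
      (norm_covDerivFwd_le hη (hU1 y κ) (G f)).trans (mul_le_mul_of_nonneg_left (add_le_add (hG' _) (hG' _)) (inv_nonneg.mpr hη.le))
    simp only [wt, pow_zero, one_mul]
    calc η * ‖covDerivFwd η U₀ κ (G f) y‖ ≤ η * (η⁻¹ * (r / 2 + r / 2)) := mul_le_mul_of_nonneg_left h1 hη.le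
      _ = r := by field_simp; ring
  · -- (14): reality
    exact isSelfAdjoint_fpS hd hη hU₀ (restrS f) (fun z => by rw [restrS_apply hf]; exact hsa z) y
  · -- left inverse: `G′(Δu + 8dη⁻²u) = u` for bounded `u`
    have h := restrS_eq_fpS_of_eq hd hη hU₀ hu (J := fun y => covLap η U₀ u y + (massS d η : ℂ) • u y) (fun _ => rfl)
    show (⇑(fpS hd hη hU₀ (restrS fun y => covLap η U₀ u y + (massS d η : ℂ) • u y)) : Site d → 𝔸) = u
    rw [← h]
    exact funext fun z => restrS_apply hu z

end Clauses

end Literature.MathematicalPhysics.QuantumFieldTheory.Balaban1983to89.B9Thm31MassiveSiteResolventLinftyZd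

end
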